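import Summits.HodgeConjecture.CorCM.Census.CoinvariantOddHalf
import Summits.HodgeConjecture.CorCM.Census.CoinvariantCyclic

/-!
# The coinvariant fibre `φ₂(G, c)`, XII: COMPLEMENTED involutions (`G = A × ⟨c⟩`) — the complement as a base type, the sum of
# its single flips, and why that sum lies in `rad2`

COR-CM (cell `pub-hodgecm2`), count-neutral kernel combinatorics by the binder seat b09 (gen 31; lane DIRECT-FACTOR = gen 29ʼs
RECOMMENDED NEXT of `Census/CoinvariantFibre.lean` … `Census/CoinvariantOddHalf.lean`), part XII.  Theorems + two bookkeeping
definitions with bodies (`cplT`, the complement read as a CM type; `sigma1`, the sum of all single flips of a type); no `decide`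
beyond numerals of `ZMod 2`, no certificate, no named fact, no `sorry`.  HONEST FRAMING: `HC_CM` is NOT proved, here or anywhere in
the tree; nothing here is a period or a headline.

THE SETTING.  `G` finite, `c` a central involution, and a **complement** of `c`: a subgroup `A ≤ G` with `x ∈ A ↔ c·x ∉ A` for
every `x` — i.e. `G = A ⊔ cA = A × ⟨c⟩` (any finite `A`, abelian or not).  For a Galois CM field `F` this says that `F` contains an
imaginary quadratic field `K` (`A = Gal(F/K)`, `F = F⁺K`) — the unitary ∕ COR-CM situation `F ⊇ E`.  The complement `A` is then
ITSELF an abstract CM type `T = cplT` (§1), fixed by every base change along `A` (`rt_cplT`), so that its single flips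
`T^{(d)} = oflipCM d T` (`d ∈ A`) form ONE `A`-orbit and their sum `Σ₁ = sigma1 T = Σ_{d ∈ T} [T^{(d)}]` is `A`-invariant.

THE POINT OF THIS PART (`sigma1_cplT_mem_rad2`).  **If `|A| = |G|/2` is even then `Σ₁ ∈ rad2 = pairs + coboundaries of faces.**
Proof: Cauchy gives `b ∈ A` of order `2`; a transversal `S₀ ⊂ A` of the pairs `{s, sb}` (read off a CM type of the involution `b`,
`exists_halfSet`) has `A = S₀ ⊔ S₀b`, so `Σ₁ = E·b⁻¹ + E` for `E = Σ_{s ∈ S₀} [T^{(s)}]`; the type `Ψ₀ = S₀ ⊔ c(A ∖ S₀)` (`mixT`) has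
`Ψ₀·b⁻¹ = Ψ₀·c = Ψ̄₀` (`rt_mixT`), so `[Ψ₀]·b⁻¹ − [Ψ₀]` is ONE pair; and `E′ = E + [Ψ₀] + (|S₀|+1)[T]` has constant type sum, i.e. is
a Hodge vector mod `2` (part V `mem_hodge2_of_forall_ts2_eq`).  Hence `Σ₁ = (E′·b⁻¹ − E′) + ([Ψ₀] + [Ψ̄₀]) ∈ rad2` (part I
`mapDomain_rt_sub_mem_rad2`).  Part XIII (`Census/CoinvariantComplementLaw.lean`) turns this into `hodge2 ∩ ker par2 ≤ rad2` and
**`φ₂ = β − 1 − δ` for every complemented `c`** (`|A|` even: `φ₂ + 2 = β`; `|A|` odd is part X) — gen 29ʼs DIRECT-FACTOR conjecture;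
cohomologically `Σ₁` is the lift of the generator of `H₁(A; 𝔽₂[A]/N) ≅ 𝔽₂`.

ALSO HERE (§2, toolkit for XIII): the type sum of a single flip (`ite_mem_oflipCM`), the pair identity mod `2` (`ts2_add_ts2_cmul`),
place sums over a type (`sum_mul_ite_mem_orb`), `ts2 Σ₁ = |T|·1_T + 𝟙` (`ts2_sigma1`), and base change of flips of `cplT`.

## References
* [Pohlmann1968] H. Pohlmann, Algebraic cycles on abelian varieties of complex multiplication type, Ann. of Math. 88 (1968), Thm 1.
-/

namespace Summit.HodgeConjecture.CorCM.Census.Coinvariant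

open Finset
open scoped symmDiff
open Summit.HodgeConjecture.CorCM.Prior.AllgGroup.RfwfAllgGroup
open Summit.HodgeConjecture.CorCM.Census.BlockParity

noncomputable section

variable {G : Type*} [Group G] [Fintype G] [DecidableEq G] (c : G)

/-! ## §1 Complements of the involution, read as CM types -/

omit [Fintype G] [DecidableEq G] in
/-- A complement does not contain `c`. [folklore] -/
theorem self_notMem_cpl (hc2 : c * c = 1) {A : Subgroup G} (hA : ∀ x : G, x ∈ A ↔ c * x ∉ A) : c ∉ A := by
  intro h
  have h1 := (hA c).mp h
  rw [hc2] at h1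
  exact h1 A.one_mem

omit [Fintype G] [DecidableEq G] in
/-- Outside a complement, `c·x` is inside. [folklore] -/
theorem cmul_mem_cpl {A : Subgroup G} (hA : ∀ x : G, x ∈ A ↔ c * x ∉ A) {x : G} (hx : x ∉ A) : c * x ∈ A := by
  by_contra h; exact hx ((hA x).mpr h)

omit [Fintype G] [DecidableEq G] in
/-- A complement element is never `c·d` with `d` in the complement. [folklore] -/
theorem ne_cmul_of_mem_cpl {A : Subgroup G} (hA : ∀ x : G, x ∈ A ↔ c * x ∉ A) {x d : G} (hx : x ∈ A) (hd : d ∈ A) :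
    x ≠ c * d := fun h => (hA d).mp hd (h ▸ hx)

/-- **The complement as a CM type** `T = A` (`G = A ⊔ cA`). [folklore] -/
def cplT (A : Subgroup G) (hA : ∀ x : G, x ∈ A ↔ c * x ∉ A) : CMF G c := by
  classical
  exact ⟨univ.filter (· ∈ A), fun x => by simpa using hA x⟩

/-- Membership in `cplT` is membership in `A`. [folklore] -/
@[simp] theorem mem_cplT {A : Subgroup G} (hA : ∀ x : G, x ∈ A ↔ c * x ∉ A) (x : G) : x ∈ (cplT c A hA).1 ↔ x ∈ A := by
  unfold cplT; simp

/-- **The complement type is fixed by base change along the complement**: `A·a⁻¹ = A`. [folklore] -/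
theorem rt_cplT {A : Subgroup G} (hA : ∀ x : G, x ∈ A ↔ c * x ∉ A) {a : G} (ha : a ∈ A) : rt c a (cplT c A hA) = cplT c A hA := by
  apply Subtype.ext; ext P
  rw [mem_rt, mem_cplT, mem_cplT]
  exact Subgroup.mul_mem_cancel_right A ha

/-- `[A]·a⁻¹ = [A]` in `𝔽₂[types]`. [folklore] -/
theorem mapDomain_rt_single_cplT {A : Subgroup G} (hA : ∀ x : G, x ∈ A ↔ c * x ∉ A) {a : G} (ha : a ∈ A) (r : ZMod 2) :
    Finsupp.mapDomain (rt c a) (Finsupp.single (cplT c A hA) r) = Finsupp.single (cplT c A hA) r := by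
  rw [Finsupp.mapDomain_single, rt_cplT c hA ha]

/-- **Base change of a single flip of the complement type**: `(A^{(d)})·a⁻¹ = A^{(da⁻¹)}`. [folklore] -/
theorem rt_oflipCM_cplT (hc2 : c * c = 1) {A : Subgroup G} (hA : ∀ x : G, x ∈ A ↔ c * x ∉ A) {a : G} (ha : a ∈ A) (d : G) :
    rt c a (oflipCM c hc2 d (cplT c A hA)) = oflipCM c hc2 (d * a⁻¹) (cplT c A hA) := by
  rw [rt_oflipCM c hc2, rt_cplT c hA ha]

/-- `|A| = |G|/2`: the complement type has `|G|/2` members. [folklore] -/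
theorem card_cplT (hc2 : c * c = 1) {A : Subgroup G} (hA : ∀ x : G, x ∈ A ↔ c * x ∉ A) :
    (cplT c A hA).1.card = Fintype.card G / 2 := by
  have h := two_mul_card_val c hc2 (cplT c A hA)
  omega

/-- `Nat.card A = |G|/2`. [folklore] -/
theorem natCard_cpl (hc2 : c * c = 1) {A : Subgroup G} (hA : ∀ x : G, x ∈ A ↔ c * x ∉ A) :
    Nat.card A = Fintype.card G / 2 := by
  classical
  rw [← card_cplT c hc2 hA, Nat.card_eq_fintype_card]
  exact Fintype.card_of_subtype _ (fun x => mem_cplT c hA x)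

/-! ## §2 Single flips, the pair identity mod `2`, place sums, and `Σ₁` -/

/-- **The type sum of a single flip**: `1_{Ψ^{(t)}} = 1_Ψ + 1_{{t, ct}}` mod `2`. [folklore] -/
theorem ite_mem_oflipCM (hc2 : c * c = 1) (t : G) (Ψ : CMF G c) (x : G) :
    (if x ∈ (oflipCM c hc2 t Ψ).1 then (1 : ZMod 2) else 0) = (if x ∈ Ψ.1 then 1 else 0) + (if x ∈ orb c t then 1 else 0) := by
  have hm : x ∈ (oflipCM c hc2 t Ψ).1 ↔ x ∈ Ψ.1 ∆ orb c t := Iff.rfl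
  by_cases h1 : x ∈ Ψ.1 <;> by_cases h2 : x ∈ orb c t <;> simp [hm, Finset.mem_symmDiff, h1, h2]
  decide

/-- `ts2` of a single flip: `ts2 [Ψ^{(t)}] x = ts2 [Ψ] x + [x ∈ {t, ct}]`. [folklore] -/
theorem ts2_single_oflipCM (hc2 : c * c = 1) (t : G) (Ψ : CMF G c) (x : G) :
    ts2 c (Finsupp.single (oflipCM c hc2 t Ψ) 1) x = ts2 c (Finsupp.single Ψ 1) x + (if x ∈ orb c t then 1 else 0) := by
  rw [ts2_single, ts2_single, ite_mem_oflipCM]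

/-- **The pair identity mod `2`**: `ts2 v (x) + ts2 v (cx) = Σ_Ψ v(Ψ)` — every type contains exactly one of `x, cx`. [folklore] -/
theorem ts2_add_ts2_cmul (v : CMF G c →₀ ZMod 2) (x : G) : ts2 c v x + ts2 c v (c * x) = v.sum fun _ a => a := by
  induction v using Finsupp.induction_linear with
  | zero => simp
  | add f g hf hg =>
    rw [map_add, Pi.add_apply, Pi.add_apply, Finsupp.sum_add_index' (fun _ => rfl) (fun _ _ _ => rfl), ← hf, ← hg]
    ring
  | single Ψ a =>
    rw [ts2_single, ts2_single, Finsupp.sum_single_index rfl]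
    by_cases hx : x ∈ Ψ.1
    · rw [if_pos hx, if_neg ((Ψ.2 x).mp hx), add_zero]
    · have hcx : c * x ∈ Ψ.1 := by by_contra h; exact hx ((Ψ.2 x).mpr h)
      rw [if_neg hx, if_pos hcx, zero_add]

/-- The pair identity, normalised at `1`: `ts2 v x + ts2 v (cx) = ts2 v 1 + ts2 v c`. [folklore] -/
theorem ts2_add_ts2_cmul_eq (v : CMF G c →₀ ZMod 2) (x : G) : ts2 c v x + ts2 c v (c * x) = ts2 c v 1 + ts2 c v c := by
  have h := ts2_add_ts2_cmul c v 1
  rw [mul_one] at h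
  rw [ts2_add_ts2_cmul, h]

/-- **Place sums over a type**: a CM type `T` meets the place `{x, cx}` in exactly one point, `x` or `cx`; so
`Σ_{d ∈ T} f(d)·[x ∈ {d, cd}] = f(x)` if `x ∈ T`, `= f(cx)` otherwise. [folklore] -/
theorem sum_mul_ite_mem_orb (hc2 : c * c = 1) (hc1 : c ≠ 1) (T : CMF G c) (f : G → ZMod 2) (x : G) :
    ∑ d ∈ T.1, f d * (if x ∈ orb c d then 1 else 0) = if x ∈ T.1 then f x else f (c * x) := by
  have hne : x ≠ c * x := fun h => hc1 (mul_right_cancel (h.symm.trans (one_mul x).symm))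
  have hsplit : ∀ d, (f d * if x ∈ orb c d then (1 : ZMod 2) else 0) =
      (if d = x then f d else 0) + (if d = c * x then f d else 0) := by
    intro d
    have hiff : x ∈ orb c d ↔ d = x ∨ d = c * x := by
      rw [mem_orb]
      constructor
      · rintro (rfl | rfl)
        · exact Or.inl rfl
        · exact Or.inr (by rw [← mul_assoc, hc2, one_mul])
      · rintro (rfl | rfl)
        · exact Or.inl rfl
        · exact Or.inr (by rw [← mul_assoc, hc2, one_mul])
    by_cases h1 : d = x
    · subst h1
      rw [if_pos (hiff.mpr (Or.inl rfl)), if_pos rfl, if_neg hne, mul_one, add_zero]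
    · by_cases h2 : d = c * x
      · rw [if_pos (hiff.mpr (Or.inr h2)), if_neg h1, if_pos h2, mul_one, zero_add]
      · rw [if_neg (fun h => (hiff.mp h).elim h1 h2), if_neg h1, if_neg h2, mul_zero, add_zero]
  simp_rw [hsplit]
  rw [Finset.sum_add_distrib, Finset.sum_ite_eq' T.1 x, Finset.sum_ite_eq' T.1 (c * x)]
  by_cases hx : x ∈ T.1
  · rw [if_pos hx, if_neg ((T.2 x).mp hx), if_pos hx, add_zero]
  · have hcx : c * x ∈ T.1 := by by_contra h; exact hx ((T.2 x).mpr h)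
    rw [if_neg hx, if_pos hcx, if_neg hx, zero_add]

/-- **`Σ₁(T) = Σ_{d ∈ T} [T^{(d)}]`**: the sum of all single flips of the type `T` in `𝔽₂[types]`. [folklore] -/
def sigma1 (hc2 : c * c = 1) (T : CMF G c) : CMF G c →₀ ZMod 2 := ∑ d ∈ T.1, Finsupp.single (oflipCM c hc2 d T) 1

/-- **`ts2 Σ₁(T) = |T|·1_T + 𝟙`.** [folklore] -/
theorem ts2_sigma1 (hc2 : c * c = 1) (hc1 : c ≠ 1) (T : CMF G c) (x : G) :
    ts2 c (sigma1 c hc2 T) x = (T.1.card : ZMod 2) * (if x ∈ T.1 then 1 else 0) + 1 := by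
  rw [sigma1, map_sum, Finset.sum_apply]
  simp_rw [ts2_single_oflipCM, Finset.sum_add_distrib, Finset.sum_const, nsmul_eq_mul, ts2_single]
  congr 1
  have h := sum_mul_ite_mem_orb c hc2 hc1 T (fun _ => 1) x
  simp only [one_mul, ite_self] at h
  exact h

/-- **`Σ₁` of the complement type is fixed by base change along the complement.** [folklore] -/
theorem mapDomain_rt_sigma1_cplT (hc2 : c * c = 1) {A : Subgroup G} (hA : ∀ x : G, x ∈ A ↔ c * x ∉ A) {a : G} (ha : a ∈ A) :
    Finsupp.mapDomain (rt c a) (sigma1 c hc2 (cplT c A hA)) = sigma1 c hc2 (cplT c A hA) := by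
  rw [sigma1, Finsupp.mapDomain_finsetSum]
  simp_rw [Finsupp.mapDomain_single, rt_oflipCM_cplT c hc2 hA ha]
  exact Finset.sum_equiv (Equiv.mulRight a⁻¹) (fun d => by
      rw [mem_cplT, mem_cplT, Equiv.coe_mulRight]; exact (Subgroup.mul_mem_cancel_right A (A.inv_mem ha)).symm)
    (fun d _ => rfl)

/-- The sum of the flips at `d·a⁻¹`, `d ∈ A`, is again `Σ₁`. [folklore] -/
theorem sum_single_oflipCM_mul_inv (hc2 : c * c = 1) {A : Subgroup G} (hA : ∀ x : G, x ∈ A ↔ c * x ∉ A) {a : G} (ha : a ∈ A) :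
    ∑ d ∈ (cplT c A hA).1, Finsupp.single (oflipCM c hc2 (d * a⁻¹) (cplT c A hA)) (1 : ZMod 2) = sigma1 c hc2 (cplT c A hA) := by
  have h := mapDomain_rt_sigma1_cplT c hc2 hA ha
  rw [sigma1, Finsupp.mapDomain_finsetSum] at h
  simp_rw [Finsupp.mapDomain_single, rt_oflipCM_cplT c hc2 hA ha] at h
  rw [← sigma1] at h
  exact h

/-- Place sums over a SUBSET `S` of a type `T`: `Σ_{d ∈ S} f(d)·[x ∈ {d, cd}]` picks `f` at the unique point of `{x, cx} ∩ T` if it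
lies in `S`, else `0`. [folklore] -/
theorem sum_mul_ite_mem_orb_of_subset (hc2 : c * c = 1) (hc1 : c ≠ 1) (T : CMF G c) {S : Finset G} (hS : S ⊆ T.1)
    (f : G → ZMod 2) (x : G) :
    ∑ d ∈ S, f d * (if x ∈ orb c d then 1 else 0) =
      if x ∈ T.1 then (if x ∈ S then f x else 0) else (if c * x ∈ S then f (c * x) else 0) := by
  have h := sum_mul_ite_mem_orb c hc2 hc1 T (fun d => if d ∈ S then f d else 0) x
  rw [← Finset.sum_subset hS (fun d _ hd => by rw [if_neg hd, zero_mul])] at h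
  rw [← h]
  exact Finset.sum_congr rfl fun d hd => by rw [if_pos hd]

/-! ## §3 `|A|` even: an element of order two, a half-set, the mixed type, and `Σ₁ ∈ rad2` -/

/-- **Cauchy in the complement**: if `|G|/2 = |A|` is even, `A` contains an involution `b`. [folklore] -/
theorem exists_mem_cpl_mul_self_eq_one (hc2 : c * c = 1) {A : Subgroup G} (hA : ∀ x : G, x ∈ A ↔ c * x ∉ A)
    (heven : Even (Fintype.card G / 2)) : ∃ b ∈ A, b * b = 1 ∧ b ≠ 1 := by
  have hdvd : 2 ∣ Nat.card A := by rw [natCard_cpl c hc2 hA]; exact even_iff_two_dvd.mp heven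
  haveI : Fact (Nat.Prime 2) := ⟨Nat.prime_two⟩
  obtain ⟨x, hx⟩ := exists_prime_orderOf_dvd_card' 2 hdvd
  have hx' : orderOf (x : G) = 2 := by rw [Subgroup.orderOf_coe, hx]
  refine ⟨x, x.2, by rw [← pow_two, ← hx', pow_orderOf_eq_one], fun h1 => ?_⟩
  rw [h1, orderOf_one] at hx'
  exact absurd hx' (by norm_num)

/-- **A half-set** of the complement for an involution `b ∈ A`: `S₀ ⊆ A` with `A = S₀ ⊔ S₀·b` — read off (by inversion) a CM type of
the involution `b` (`exists_isCMF`). [folklore] -/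
theorem exists_halfSet {A : Subgroup G} (hA : ∀ x : G, x ∈ A ↔ c * x ∉ A) {b : G} (hb : b ∈ A) (hb2 : b * b = 1) (hb1 : b ≠ 1) :
    ∃ S₀ : Finset G, S₀ ⊆ (cplT c A hA).1 ∧ ∀ a ∈ A, a ∈ S₀ ↔ a * b ∉ S₀ := by
  obtain ⟨Φ, hΦ⟩ := exists_isCMF b hb2 hb1
  refine ⟨(cplT c A hA).1.filter (fun x => x⁻¹ ∈ Φ), Finset.filter_subset _ _, fun a ha => ?_⟩
  have hab : a * b ∈ A := A.mul_mem ha hb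
  have hbinv : b⁻¹ = b := inv_eq_of_mul_eq_one_right hb2
  simp only [Finset.mem_filter, mem_cplT, ha, hab, true_and, mul_inv_rev, hbinv]
  exact hΦ a⁻¹

/-- **The mixed type** `Ψ₀ = S₀ ⊔ c·(A ∖ S₀)` of a subset `S₀ ⊆ A`: the complement type `A` flipped at every place of `A ∖ S₀`.
[folklore] -/
def mixT (hc2 : c * c = 1) {A : Subgroup G} (hA : ∀ x : G, x ∈ A ↔ c * x ∉ A) (S₀ : Finset G) (hS : S₀ ⊆ (cplT c A hA).1) :
    CMF G c := by
  classical
  refine ⟨univ.filter (fun x => x ∈ S₀ ∨ (x ∉ A ∧ c * x ∉ S₀)), fun x => ?_⟩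
  have hSA : ∀ y, y ∈ S₀ → y ∈ A := fun y hy => (mem_cplT c hA y).mp (hS hy)
  simp only [Finset.mem_filter, Finset.mem_univ, true_and, cmul_cmul c hc2]
  by_cases hx : x ∈ A
  · have hcx : c * x ∉ A := (hA x).mp hx
    have hcxS : c * x ∉ S₀ := fun h => hcx (hSA _ h)
    tauto
  · have hcx : c * x ∈ A := cmul_mem_cpl c hA hx
    have hxS : x ∉ S₀ := fun h => hx (hSA _ h)
    tauto

/-- Membership in the mixed type. [folklore] -/
theorem mem_mixT (hc2 : c * c = 1) {A : Subgroup G} (hA : ∀ x : G, x ∈ A ↔ c * x ∉ A) {S₀ : Finset G}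
    (hS : S₀ ⊆ (cplT c A hA).1) (x : G) : x ∈ (mixT c hc2 hA S₀ hS).1 ↔ x ∈ S₀ ∨ (x ∉ A ∧ c * x ∉ S₀) := by
  unfold mixT; simp

/-- **The mixed type of a half-set is turned into its conjugate by `b`**: `Ψ₀·b⁻¹ = Ψ₀·c = Ψ̄₀`. [folklore] -/
theorem rt_mixT (hc2 : c * c = 1) (hcen : ∀ x : G, x * c = c * x) {A : Subgroup G} (hA : ∀ x : G, x ∈ A ↔ c * x ∉ A)
    {b : G} (hb : b ∈ A) {S₀ : Finset G} (hS : S₀ ⊆ (cplT c A hA).1) (hS₀ : ∀ a ∈ A, a ∈ S₀ ↔ a * b ∉ S₀) :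
    rt c b (mixT c hc2 hA S₀ hS) = rt c c (mixT c hc2 hA S₀ hS) := by
  have hSA : ∀ y, y ∈ S₀ → y ∈ A := fun y hy => (mem_cplT c hA y).mp (hS hy)
  apply Subtype.ext; ext P
  rw [mem_rt, mem_rt, mem_mixT, mem_mixT, hcen P, cmul_cmul c hc2, ← mul_assoc]
  by_cases hP : P ∈ A
  · have hPb : P * b ∈ A := A.mul_mem hP hb
    have hcP : c * P ∉ A := (hA P).mp hP
    have hcPS : c * P ∉ S₀ := fun h => hcP (hSA _ h)
    have key := hS₀ P hP
    tauto
  · have hPb : P * b ∉ A := fun h => hP ((Subgroup.mul_mem_cancel_right A hb).mp h)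
    have hPbS : P * b ∉ S₀ := fun h => hPb (hSA _ h)
    have hcP : c * P ∈ A := cmul_mem_cpl c hA hP
    have key := hS₀ (c * P) hcP
    tauto

/-- **`Σ₁(A) ∈ rad2` when `|A| = |G|/2` is even** — the lift of the generator of `H₁(A; 𝔽₂[A]/N) ≅ 𝔽₂`:
`Σ₁ = (E′·b⁻¹ − E′) + ([Ψ₀] + [Ψ̄₀])` with `E′ = Σ_{s ∈ S₀}[A^{(s)}] + [Ψ₀] + (|S₀|+1)[A]` a Hodge vector mod `2`. [folklore] -/
theorem sigma1_cplT_mem_rad2 (hc2 : c * c = 1) (hc1 : c ≠ 1) (hcen : ∀ x : G, x * c = c * x) {A : Subgroup G}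
    (hA : ∀ x : G, x ∈ A ↔ c * x ∉ A) (heven : Even (Fintype.card G / 2)) : sigma1 c hc2 (cplT c A hA) ∈ rad2 c hc2 := by
  classical
  obtain ⟨b, hb, hb2, hb1⟩ := exists_mem_cpl_mul_self_eq_one c hc2 hA heven
  obtain ⟨S₀, hS, hS₀⟩ := exists_halfSet c hA hb hb2 hb1
  have hbinv : b⁻¹ = b := inv_eq_of_mul_eq_one_right hb2
  have hSA : ∀ y, y ∈ S₀ → y ∈ A := fun y hy => (mem_cplT c hA y).mp (hS hy)
  set E : CMF G c →₀ ZMod 2 := ∑ s ∈ S₀, Finsupp.single (oflipCM c hc2 s (cplT c A hA)) 1 with hE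
  set F : CMF G c →₀ ZMod 2 := ∑ s ∈ S₀, Finsupp.single (oflipCM c hc2 (s * b) (cplT c A hA)) 1 with hF
  set κ : ZMod 2 := (S₀.card : ZMod 2) + 1 with hκ
  set E' : CMF G c →₀ ZMod 2 := E + Finsupp.single (mixT c hc2 hA S₀ hS) 1 + κ • Finsupp.single (cplT c A hA) 1 with hE'
  -- (1) `E·b⁻¹ = F`
  have hEb : Finsupp.mapDomain (rt c b) E = F := by
    rw [hE, hF, Finsupp.mapDomain_finsetSum]
    simp_rw [Finsupp.mapDomain_single, rt_oflipCM_cplT c hc2 hA hb, hbinv]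
  -- (2) `Σ₁ = E + F` (`A = S₀ ⊔ S₀ b`)
  have hsdiff : (cplT c A hA).1 \ S₀ = S₀.image (· * b) := by
    ext x
    rw [Finset.mem_sdiff, Finset.mem_image, mem_cplT]
    constructor
    · rintro ⟨hx, hxS⟩
      refine ⟨x * b, ?_, by rw [mul_assoc, hb2, mul_one]⟩
      by_contra h
      exact hxS (by have := hS₀ x hx; tauto)
    · rintro ⟨s, hs, rfl⟩
      exact ⟨A.mul_mem (hSA s hs) hb, (hS₀ s (hSA s hs)).mp hs⟩
  have hsig : sigma1 c hc2 (cplT c A hA) = E + F := by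
    rw [sigma1, ← Finset.sum_sdiff hS, add_comm, hsdiff, Finset.sum_image fun x _ y _ h => mul_right_cancel h]
  -- (3) `E'` is a Hodge vector mod 2: its type sum is the constant `1`
  have hE'H : E' ∈ hodge2 c hc2 := by
    refine mem_hodge2_of_forall_ts2_eq c hc2 hc1 hcen (a := 1) fun x => ?_
    have hEx : ts2 c E x = (S₀.card : ZMod 2) * (if x ∈ (cplT c A hA).1 then 1 else 0) +
        (if x ∈ (cplT c A hA).1 then (if x ∈ S₀ then 1 else 0) else (if c * x ∈ S₀ then 1 else 0)) := by
      rw [hE, map_sum, Finset.sum_apply]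
      simp_rw [ts2_single_oflipCM, Finset.sum_add_distrib, Finset.sum_const, nsmul_eq_mul, ts2_single]
      congr 1
      have h := sum_mul_ite_mem_orb_of_subset c hc2 hc1 (cplT c A hA) hS (fun _ => 1) x
      simp only [one_mul] at h
      rw [h]
    rw [hE', map_add, map_add, map_smul, Pi.add_apply, Pi.add_apply, Pi.smul_apply, hEx, ts2_single, ts2_single,
      smul_eq_mul, hκ]
    simp only [mem_cplT, mem_mixT]
    by_cases hx : x ∈ A
    · by_cases hxS : x ∈ S₀
      · simp only [hx, hxS, if_true, true_or, not_true_eq_false, false_and]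
        generalize (S₀.card : ZMod 2) = k; revert k; decide
      · simp only [hx, hxS, if_true, if_false, not_true_eq_false, false_and, or_false]
        generalize (S₀.card : ZMod 2) = k; revert k; decide
    · have hxS : x ∉ S₀ := fun h => hx (hSA _ h)
      by_cases hcxS : c * x ∈ S₀
      · simp only [hx, hxS, hcxS, if_true, if_false, not_false_eq_true, not_true_eq_false, and_false, or_false]
        generalize (S₀.card : ZMod 2) = k; revert k; decide
      · simp only [hx, hxS, hcxS, if_false, not_false_eq_true, and_self, or_true, if_true]
        generalize (S₀.card : ZMod 2) = k; revert k; decide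
  -- (4) `[Ψ₀]·b⁻¹ − [Ψ₀]` is a pair
  have hpair : Finsupp.mapDomain (rt c b) (Finsupp.single (mixT c hc2 hA S₀ hS) (1 : ZMod 2)) -
      Finsupp.single (mixT c hc2 hA S₀ hS) 1 ∈ pair2 c := by
    rw [Finsupp.mapDomain_single, rt_mixT c hc2 hcen hA hb hS hS₀, ← Finsupp.mapDomain_single]
    exact mapDomain_rt_self_sub_mem_pair2 c _
  -- (5) assemble
  have e : sigma1 c hc2 (cplT c A hA) = (Finsupp.mapDomain (rt c b) E' - E') -
      (Finsupp.mapDomain (rt c b) (Finsupp.single (mixT c hc2 hA S₀ hS) (1 : ZMod 2)) -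
        Finsupp.single (mixT c hc2 hA S₀ hS) 1) := by
    rw [hsig, hE', Finsupp.mapDomain_add, Finsupp.mapDomain_add, Finsupp.mapDomain_smul, hEb,
      mapDomain_rt_single_cplT c hA hb]
    have h1 : F + Finsupp.mapDomain (rt c b) (Finsupp.single (mixT c hc2 hA S₀ hS) (1 : ZMod 2)) +
        κ • Finsupp.single (cplT c A hA) (1 : ZMod 2) -
        (E + Finsupp.single (mixT c hc2 hA S₀ hS) 1 + κ • Finsupp.single (cplT c A hA) 1) -
        (Finsupp.mapDomain (rt c b) (Finsupp.single (mixT c hc2 hA S₀ hS) (1 : ZMod 2)) -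
          Finsupp.single (mixT c hc2 hA S₀ hS) 1) = F + -E := by abel
    rw [h1, neg_eq_self_finsuppTwo, add_comm]
  rw [e]
  exact Submodule.sub_mem _ (mapDomain_rt_sub_mem_rad2 c hc2 hcen b hE'H) (pair2_le_rad2 c hc2 hpair)

end

end Summit.HodgeConjecture.CorCM.Census.Coinvariant
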